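import Summits.NavierStokesRegularity.NavierStokesRegularity.Theses.AxisymmetricExtremality
import Summits.NavierStokesRegularity.NavierStokesRegularity.Theorems.AxisymmetricExtremalityAxisymmetricKatoGlobalStubSereginLogSwirlOriginStep3Gamma
import Summits.NavierStokesRegularity.NavierStokesRegularity.Theorems.AxisymmetricExtremalityAxisymmetricKatoGlobalStubSereginLogSwirlOriginStep3Balance
import HarnessLib

/-!
# Seregin 2022, §2 Step 3: the time-integrated localised energy inequalities of `Γ = ω_θ/r` and
# `Φ = ω_r/r` along a classical axisymmetric solution on a slab (S3a, S3b) —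
# crux stmt-NavierStokesRegularity-15453 (`AxisymmetricExtremality.AxisymmetricKatoGlobal`), line registered, support for stub `stub_sereginLogSwirlOrigin`

Support file (`--supports stmt-NavierStokesRegularity-15453`; theorems only, everything proved)
toward the registered stub `stub_sereginLogSwirlOrigin` = the named fact
`Literature.Analysis.FluidPDE.seregin2022_logSwirl_regularAtOrigin` (G. Seregin, J. Math. Fluid
Mech. 24 (2022), Paper 27 = arXiv:2201.00153, §2). Step 3 (arXiv pp. 6–7) derives, for the
cut-off `η(r, x₃, t)` of Step 1 and `Φ = ω_r/r`, `Γ = ω_θ/r`,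
`½∂ₜ∫(Φη³)² + ∫(η³|∇Φ|)² + π∫(η³Φ)²|_{x'=0}dx₃ = A₁ + A₂ + A₃`,
`½∂ₜ∫(Γη³)² + ∫(η³|∇Γ|)² + π∫(η³Γ)²|_{x'=0}dx₃ = B₁ + B₂ + B₃`, and integrates in time. This file
states the two inequalities in integrated form, for a CLASSICAL axisymmetric solution of the
unforced system with viscosity `ν ≥ 0` on an open time interval `(T₀, T₁)` (the singularity-free
slab of Step 1), a cut-off `ζ = η³` jointly smooth on `(T₀, T₁) × ℝ³`, axisymmetric in space and
vanishing off a fixed compact set `K`, and `[t₁, t₂] ⊆ (T₀, T₁)`: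

* `angVortQuot_cutoff_energy_balance_le` (registered sub-goal, S3a) — with `Γ = angVortQuot (v t)`,
  `v_θ/r = angVelQuot (v t)`, `Φ = radVelQuot (curl (v t))`, `E_Γ(t) = ∫(ζΓ)²(t)`:
  `E_Γ(t₂) + 2ν∫_{t₁}^{t₂}∫|∇(ζΓ)|² ≤ E_Γ(t₁) + ∫_{t₁}^{t₂}[2∫ζ∂ₜζΓ² + 2∫ζΓ²Dζ[v] + 2ν∫Γ²|∇ζ|²
  − 4ν∫ζΓ²q_ζ − 4∫ζ²Γ(v_θ/r)Φ] dt` — `B₁ + B₂` are the four cut-off terms (supported on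
  `supp ∇ζ ∪ supp ∂ₜζ`), `B₃ = −2∫(v_θ/r)(η³Φ)(η³Γ)` the last;
* `radVelQuot_curl_cutoff_energy_balance_le` (registered sub-goal, S3b) — with
  `Φ = radVelQuot (curl (v t))`, `v_r/r = radVelQuot (v t)`, `ω = curl (v t)`:
  `E_Φ(t₂) + 2ν∫_{t₁}^{t₂}∫|∇(ζΦ)|² ≤ E_Φ(t₁) + ∫_{t₁}^{t₂}[2∫ζ∂ₜζΦ² + 2∫ζΦ²Dζ[v] + 2ν∫Φ²|∇ζ|²
  − 4ν∫ζΦ²q_ζ + 2∫ζ²Φ D(v_r/r)[ω]] dt` — `A₃ = ∫ η⁶Φ ω·∇(v_r/r)`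
  (`= ∫(v_θ(v_r/r),₃(Φη⁶),ᵣ − v_θ(v_r/r),ᵣ(Φη⁶),₃)` after the paper's integration by parts).

Both are `integral_cutoff_sq_add_le_of_forall_le` (`…Step3Balance`) fed with the fixed-time
inequalities `angVortQuot_cutoff_energy_le`, `radVelQuot_curl_cutoff_energy_le` (`…Step3Gamma`,
axis terms already dropped by sign) and the exchange of `∂ₜ` with the Hou–Li quotients
(`IsSmoothSpaceTimeOn.timeDerivWithin_angVortQuot`, `.timeDerivWithin_radVelQuot` of the
vorticity family, `.timeDerivWithin_vorticity_eq`). What remains of Step 3 after this file is the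
ABSORPTION (S3c): bounding `B₃` and `A₃` by `(cC₁/ln(e/r₁) + cC₁²/ln⁴(e/r₁))‖η³∇Γ‖‖η³∇Φ‖ + …`
with Lemma 2.2 (`seregin2022_lemma22`), Lemma 2.1 and the swirl bound (2.2), under the smallness
`exists_radius_logSmall`.

## Mathlib / tree search

Tree: `integral_cutoff_sq_add_le_of_forall_le` (`…Step3Balance`), `angVortQuot_cutoff_energy_le`,
`radVelQuot_curl_cutoff_energy_le` (`…Step3Gamma`), `IsSmoothSpaceTimeOn.angVortQuot_family /
angVelQuot_family / radVelQuot_family / timeDerivWithin_angVortQuot / timeDerivWithin_radVelQuot`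
(`HouLiSpaceTime`), `IsSmoothSpaceTimeOn.isSmoothSpaceTimeOn_vorticity`,
`.timeDerivWithin_vorticity_eq`, `IsAxisymmetric.curl`, `isSmoothSpaceTimeOn_const_time`,
`IsSmoothSpaceTimeOn.fderiv_slice`. `lean search 'cutoff_energy_balance'`: no matches (2026-08-17).

## References

* G. Seregin, J. Math. Fluid Mech. 24 (2022), Paper No. 27 = arXiv:2201.00153, §2 Step 3
  (arXiv pp. 6–7). [`Seregin2022LocalAxisym`]
-/

noncomputable section

open MeasureTheory Set Filter Topology Function intervalIntegral
open scoped ENNReal ContDiff Laplacian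
open Literature.Analysis.FluidPDE

-- `<Problem> = <Summit>` duplicates a namespace component by design (lakefile sets the same option).
set_option linter.dupNamespace false

namespace Summit.NavierStokesRegularity.NavierStokesRegularity.Theorems.AxisymmetricKatoGlobal.EulerScaling

/-! ### The integrated `Γ`- and `Φ`-inequalities along a classical axisymmetric solution -/

section NavierStokes

variable {T₀ T₁ ν : ℝ} {v : ℝ → EuclideanSpace ℝ (Fin 3) → EuclideanSpace ℝ (Fin 3)}
  {q : ℝ → EuclideanSpace ℝ (Fin 3) → ℝ} {ζ : ℝ → EuclideanSpace ℝ (Fin 3) → ℝ}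
  {K : Set (EuclideanSpace ℝ (Fin 3))}

/-- An open interval is contained in the closure of its interior. [folklore] -/
theorem Ioo_subset_closure_interior (a b : ℝ) : Ioo a b ⊆ closure (interior (Ioo a b)) := by
  rw [isOpen_Ioo.interior_eq]; exact subset_closure

/-- **Seregin 2022, §2 Step 3 — the localised energy inequality for `Γ = ω_θ/r`, integrated in
time** (S3a). Classical axisymmetric solution of the unforced Navier–Stokes system (viscosity
`ν ≥ 0`) on an open time interval `(T₀, T₁)`; time-dependent cut-off `ζ = η³` jointly smooth on
`(T₀, T₁) × ℝ³`, axisymmetric, vanishing off a fixed compact `K`; `[t₁, t₂] ⊆ (T₀, T₁)`. With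
`Γ = angVortQuot (v t)`, `v_θ/r = angVelQuot (v t)`, `Φ = radVelQuot (curl (v t))`,
`E_Γ(t) = ∫ (ζΓ)²(t)`:
`E_Γ(t₂) + 2ν∫_{t₁}^{t₂}∫|∇(ζΓ)|² ≤ E_Γ(t₁) + ∫_{t₁}^{t₂} [2∫ζ∂ₜζΓ² + 2∫ζΓ²Dζ[v] + 2ν∫Γ²|∇ζ|²
  − 4ν∫ζΓ²q_ζ − 4∫ζ²Γ(v_θ/r)Φ] dt`
(the paper's `½∂ₜ∫(Γη³)² + ∫(η³|∇Γ|)² + π∫(η³Γ)²|_{x'=0} = B₁ + B₂ + B₃` integrated, axis term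
dropped, in the `η³Γ`-form). [cite: Seregin2022LocalAxisym, §2 Step 3 (arXiv:2201.00153 pp. 6–7, the Γη⁶ identity and its time integration)] -/
theorem angVortQuot_cutoff_energy_balance_le : ∀ (T₀ T₁ ν : ℝ) (v : ℝ → EuclideanSpace ℝ (Fin 3) → EuclideanSpace ℝ (Fin 3)) (q : ℝ → EuclideanSpace ℝ (Fin 3) → ℝ) (ζ : ℝ → EuclideanSpace ℝ (Fin 3) → ℝ) (K : Set (EuclideanSpace ℝ (Fin 3))) (t₁ t₂ : ℝ), IsClassicalNSSolutionOn (Ioo T₀ T₁) ν 0 v q → (∀ s ∈ Ioo T₀ T₁, IsAxisymmetric (v s)) → 0 ≤ ν → IsSmoothSpaceTimeOn (Ioo T₀ T₁) ζ → (∀ s ∈ Ioo T₀ T₁, IsAxisymmetricScalar (ζ s)) → IsCompact K → (∀ s ∈ Ioo T₀ T₁, ∀ x ∉ K, ζ s x = 0) → t₁ ≤ t₂ → Icc t₁ t₂ ⊆ Ioo T₀ T₁ → (∫ x, (ζ t₂ x * angVortQuot (v t₂) x) ^ 2) + 2 * ν * ∫ t in t₁..t₂, ∫ x, (fderiv ℝ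 (fun y => ζ t y * angVortQuot (v t) y) x (EuclideanSpace.single 0 1) ^ 2 + fderiv ℝ (fun y => ζ t y * angVortQuot (v t) y) x (EuclideanSpace.single 1 1) ^ 2 + fderiv ℝ (fun y => ζ t y * angVortQuot (v t) y) x (EuclideanSpace.single 2 1) ^ 2) ≤ (∫ x, (ζ t₁ x * angVortQuot (v t₁) x) ^ 2) + ∫ t in t₁..t₂, (2 * (∫ x, ζ t x * timeDerivWithin (Ioo T₀ T₁) ζ t x * angVortQuot (v t) x ^ 2) + 2 * (∫ x, ζ t x * angVortQuot (v t) x ^ 2 * fderiv ℝ (ζ t) x (v t x)) + 2 * ν * (∫ x, angVortQuot (v t) x ^ 2 * (fderiv ℝ (ζ t) x (EuclideanSpace.single 0 1) ^ 2 + fderiv ℝ (ζ t) x (EuclideanSpace.single 1 1) ^ 2 + fderiv ℝ (ζ t) x (EuclideanSpace.single 2 1) ^ 2)) - 4 * ν * (∫ x, ζ t x * angVortQuot (v t) x ^ 2 * radDerivQuot (ζ t) x) - 4 * ∫ x, ζ t x ^ 2 * angVortQuot (v t) x * (angVelQuot (v t) x * radVelQuot (curl (v t)) x)) := by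
  intro T₀ T₁ ν v q ζ K t₁ t₂ hns hax hν hζ hζax hK hsupp h12 hsub
  set S : Set ℝ := Ioo T₀ T₁ with hSdef
  have hS : IsOpen S := isOpen_Ioo
  have hU : UniqueDiffOn ℝ S := hS.uniqueDiffOn
  have hc : Convex ℝ S := convex_Ioo T₀ T₁
  have hcl : S ⊆ closure (interior S) := Ioo_subset_closure_interior T₀ T₁
  have hsm : IsSmoothSpaceTimeOn S v := hns.smooth_velocity
  have hΓ : IsSmoothSpaceTimeOn S fun s => angVortQuot (v s) := hsm.angVortQuot_family hc hU
  have hΦ : IsSmoothSpaceTimeOn S fun s => angVelQuot (v s) := hsm.angVelQuot_family hc hU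
  have hJ : IsSmoothSpaceTimeOn S fun s => radVelQuot (curl (v s)) :=
    (hsm.isSmoothSpaceTimeOn_vorticity hU).radVelQuot_family hc hU
  have hR : IsSmoothSpaceTimeOn S fun s x => -2 * (angVelQuot (v s) x * radVelQuot (curl (v s)) x) := by
    have := (isSmoothSpaceTimeOn_const_time (contDiff_const (c := (-2 : ℝ))) S).mul (hΦ.mul hJ)
    exact this
  have hsrc : ∀ t, ∫ x, ζ t x ^ 2 * angVortQuot (v t) x *
      (-2 * (angVelQuot (v t) x * radVelQuot (curl (v t)) x)) =
      -2 * ∫ x, ζ t x ^ 2 * angVortQuot (v t) x * (angVelQuot (v t) x * radVelQuot (curl (v t)) x) := by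
    intro t
    rw [← MeasureTheory.integral_const_mul]
    exact integral_congr_ae (Eventually.of_forall fun x => by ring)
  have h := integral_cutoff_sq_add_le_of_forall_le S ν ζ (fun s => angVortQuot (v s))
    (fun s x => -2 * (angVelQuot (v s) x * radVelQuot (curl (v s)) x)) v K t₁ t₂ hS hc hζ hΓ hR hsm
    hK hsupp (fun t ht => ?_) h12 hsub
  · have hint : ∀ t, (2 * (∫ x, ζ t x * timeDerivWithin S ζ t x * angVortQuot (v t) x ^ 2) +
          2 * (∫ x, ζ t x * angVortQuot (v t) x ^ 2 * fderiv ℝ (ζ t) x (v t x)) +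
          2 * ν * (∫ x, angVortQuot (v t) x ^ 2 * (fderiv ℝ (ζ t) x (EuclideanSpace.single 0 1) ^ 2 +
            fderiv ℝ (ζ t) x (EuclideanSpace.single 1 1) ^ 2 +
            fderiv ℝ (ζ t) x (EuclideanSpace.single 2 1) ^ 2)) -
          4 * ν * (∫ x, ζ t x * angVortQuot (v t) x ^ 2 * radDerivQuot (ζ t) x) +
          2 * ∫ x, ζ t x ^ 2 * angVortQuot (v t) x *
            (-2 * (angVelQuot (v t) x * radVelQuot (curl (v t)) x))) =
        (2 * (∫ x, ζ t x * timeDerivWithin S ζ t x * angVortQuot (v t) x ^ 2) +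
          2 * (∫ x, ζ t x * angVortQuot (v t) x ^ 2 * fderiv ℝ (ζ t) x (v t x)) +
          2 * ν * (∫ x, angVortQuot (v t) x ^ 2 * (fderiv ℝ (ζ t) x (EuclideanSpace.single 0 1) ^ 2 +
            fderiv ℝ (ζ t) x (EuclideanSpace.single 1 1) ^ 2 +
            fderiv ℝ (ζ t) x (EuclideanSpace.single 2 1) ^ 2)) -
          4 * ν * (∫ x, ζ t x * angVortQuot (v t) x ^ 2 * radDerivQuot (ζ t) x) -
          4 * ∫ x, ζ t x ^ 2 * angVortQuot (v t) x *
            (angVelQuot (v t) x * radVelQuot (curl (v t)) x)) := by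
      intro t
      rw [hsrc t]
      ring
    simp only [hint] at h
    exact h
  have hζ2 : ContDiff ℝ 2 (ζ t) := (hζ.contDiff_slice ht).of_le (by norm_cast)
  have hζc : HasCompactSupport (ζ t) := HasCompactSupport.intro hK (hsupp t ht)
  have hfix := angVortQuot_cutoff_energy_le S ν v q (ζ t) t hns hU hcl hax hν ht hζ2 (hζax t ht) hζc
  have hder : ∀ x, timeDerivWithin S (fun s => angVortQuot (v s)) t x =
      angVortQuot (timeDerivWithin S v t) x := fun x =>
    hsm.timeDerivWithin_angVortQuot hc hU hcl hax ht x
  have heq : ∫ x, ζ t x ^ 2 * angVortQuot (v t) x * timeDerivWithin S (fun s => angVortQuot (v s)) t x =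
      ∫ x, ζ t x ^ 2 * angVortQuot (v t) x * angVortQuot (timeDerivWithin S v t) x :=
    integral_congr_ae (Eventually.of_forall fun x => by beta_reduce; rw [hder x])
  beta_reduce
  rw [heq, hsrc t]
  linarith [hfix]

/-- **Seregin 2022, §2 Step 3 — the localised energy inequality for `Φ = ω_r/r`, integrated in
time** (S3b). Same setting as `angVortQuot_cutoff_energy_balance_le`; with
`Φ = radVelQuot (curl (v t))`, `v_r/r = radVelQuot (v t)`, `ω = curl (v t)`, `E_Φ(t) = ∫(ζΦ)²(t)`:
`E_Φ(t₂) + 2ν∫_{t₁}^{t₂}∫|∇(ζΦ)|² ≤ E_Φ(t₁) + ∫_{t₁}^{t₂} [2∫ζ∂ₜζΦ² + 2∫ζΦ²Dζ[v] + 2ν∫Φ²|∇ζ|²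
  − 4ν∫ζΦ²q_ζ + 2∫ζ²Φ D(v_r/r)[ω]] dt`
(the paper's `½∂ₜ∫(Φη³)² + ∫(η³|∇Φ|)² + π∫(η³Φ)²|_{x'=0} = A₁ + A₂ + A₃` integrated, axis term
dropped). [cite: Seregin2022LocalAxisym, §2 Step 3 (arXiv:2201.00153 pp. 6–7, the Φη⁶ identity and its time integration)] -/
theorem radVelQuot_curl_cutoff_energy_balance_le : ∀ (T₀ T₁ ν : ℝ) (v : ℝ → EuclideanSpace ℝ (Fin 3) → EuclideanSpace ℝ (Fin 3)) (q : ℝ → EuclideanSpace ℝ (Fin 3) → ℝ) (ζ : ℝ → EuclideanSpace ℝ (Fin 3) → ℝ) (K : Set (EuclideanSpace ℝ (Fin 3))) (t₁ t₂ : ℝ), IsClassicalNSSolutionOn (Ioo T₀ T₁) ν 0 v q → (∀ s ∈ Ioo T₀ T₁, IsAxisymmetric (v s)) → 0 ≤ ν → IsSmoothSpaceTimeOn (Ioo T₀ T₁) ζ → (∀ s ∈ Ioo T₀ T₁, IsAxisymmetricScalar (ζ s)) → IsCompact K → (∀ s ∈ Ioo T₀ T₁, ∀ x ∉ K, ζ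 s x = 0) → t₁ ≤ t₂ → Icc t₁ t₂ ⊆ Ioo T₀ T₁ → (∫ x, (ζ t₂ x * radVelQuot (curl (v t₂)) x) ^ 2) + 2 * ν * ∫ t in t₁..t₂, ∫ x, (fderiv ℝ (fun y => ζ t y * radVelQuot (curl (v t)) y) x (EuclideanSpace.single 0 1) ^ 2 + fderiv ℝ (fun y => ζ t y * radVelQuot (curl (v t)) y) x (EuclideanSpace.single 1 1) ^ 2 + fderiv ℝ (fun y => ζ t y * radVelQuot (curl (v t)) y) x (EuclideanSpace.single 2 1) ^ 2) ≤ (∫ x, (ζ t₁ x * radVelQuot (curl (v t₁)) x) ^ 2) + ∫ t in t₁..t₂, (2 * (∫ x, ζ t x * timeDerivWithin (Ioo T₀ T₁) ζ t x * radVelQuot (curl (v t)) x ^ 2) + 2 * (∫ x, ζ t x * radVelQuot (curl (v t)) x ^ 2 * fderiv ℝ (ζ t) x (v t x)) + 2 * ν * (∫ x, radVelQuot (curl (v t)) x ^ 2 * (fderiv ℝ (ζ t) x (EuclideanSpace.single 0 1) ^ 2 + fderiv ℝ (ζ t) x (EuclideanSpace.single 1 1) ^ 2 + fderiv ℝ (ζ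 t) x (EuclideanSpace.single 2 1) ^ 2)) - 4 * ν * (∫ x, ζ t x * radVelQuot (curl (v t)) x ^ 2 * radDerivQuot (ζ t) x) + 2 * ∫ x, ζ t x ^ 2 * radVelQuot (curl (v t)) x * fderiv ℝ (radVelQuot (v t)) x (curl (v t) x)) := by
  intro T₀ T₁ ν v q ζ K t₁ t₂ hns hax hν hζ hζax hK hsupp h12 hsub
  set S : Set ℝ := Ioo T₀ T₁ with hSdef
  have hS : IsOpen S := isOpen_Ioo
  have hU : UniqueDiffOn ℝ S := hS.uniqueDiffOn
  have hc : Convex ℝ S := convex_Ioo T₀ T₁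
  have hcl : S ⊆ closure (interior S) := Ioo_subset_closure_interior T₀ T₁
  have hsm : IsSmoothSpaceTimeOn S v := hns.smooth_velocity
  have hω : IsSmoothSpaceTimeOn S (vorticity v) := hsm.isSmoothSpaceTimeOn_vorticity hU
  have haxω : ∀ s ∈ S, IsAxisymmetric (vorticity v s) := fun s hs =>
    (hax s hs).curl ((hsm.contDiff_slice hs).differentiable (by simp))
  have hJ : IsSmoothSpaceTimeOn S fun s => radVelQuot (curl (v s)) := hω.radVelQuot_family hc hU
  have hW : IsSmoothSpaceTimeOn S fun s => radVelQuot (v s) := hsm.radVelQuot_family hc hU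
  have hR : IsSmoothSpaceTimeOn S fun s x => fderiv ℝ (radVelQuot (v s)) x (curl (v s) x) :=
    (hW.fderiv_slice hU).clm_apply hω
  refine integral_cutoff_sq_add_le_of_forall_le S ν ζ (fun s => radVelQuot (curl (v s)))
    (fun s x => fderiv ℝ (radVelQuot (v s)) x (curl (v s) x)) v K t₁ t₂ hS hc hζ hJ hR hsm hK hsupp
    (fun t ht => ?_) h12 hsub
  have hζ2 : ContDiff ℝ 2 (ζ t) := (hζ.contDiff_slice ht).of_le (by norm_cast)
  have hζc : HasCompactSupport (ζ t) := HasCompactSupport.intro hK (hsupp t ht)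
  have hfix := radVelQuot_curl_cutoff_energy_le S ν v q (ζ t) t hns hU hcl hax hν ht hζ2 (hζax t ht) hζc
  have hder : ∀ x, timeDerivWithin S (fun s => radVelQuot (curl (v s))) t x =
      radVelQuot (curl (timeDerivWithin S v t)) x := fun x => by
    have h1 := hω.timeDerivWithin_radVelQuot hc hU haxω ht x
    rw [hsm.timeDerivWithin_vorticity_eq hU hcl ht] at h1
    exact h1
  have heq : ∫ x, ζ t x ^ 2 * radVelQuot (curl (v t)) x *
      timeDerivWithin S (fun s => radVelQuot (curl (v s))) t x =
      ∫ x, ζ t x ^ 2 * radVelQuot (curl (v t)) x * radVelQuot (curl (timeDerivWithin S v t)) x :=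
    integral_congr_ae (Eventually.of_forall fun x => by beta_reduce; rw [hder x])
  beta_reduce
  rw [heq]
  exact hfix

end NavierStokes

end Summit.NavierStokesRegularity.NavierStokesRegularity.Theorems.AxisymmetricKatoGlobal.EulerScaling

end
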